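import Mathlib.Topology.CWComplex.Classical.Finite
import HarnessLib

/-!
# Transferring a classical CW structure along a homeomorphism (and to another universe)

Topic `Literature/AlgebraicTopology/Homotopy` (sub-namespace `CWTransfer`; it serves the CW
homotopy type of compact manifolds, Hatcher, *Algebraic Topology* (2002), Cor. A.12, vendored
next door in `WhiteheadTheorem.lean`). Mathlib's classical CW complexes
(`Topology.CWComplex C`, Hatcher, *Algebraic Topology* (2002), Appendix, pp. 519–521) are
structures on a *subset* `C` of an ambient space `X`, with the cells of dimension `n` indexed by
a type in the universe of `X`. Statements such as "`M` is homotopy equivalent to a CW complex"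
(`Literature.AlgebraicTopology.Homotopy.exists_cwComplex_homotopyEquiv_of_compactSpace`) quantify
instead over a *type* `C : Type u` carrying `Topology.CWComplex (Set.univ : Set C)`. This file
provides the (purely formal) passage between the two, which Mathlib does not have yet
(`lean search` for `CWComplex` + `Homeomorph` finds nothing):

* `Literature.AlgebraicTopology.Homotopy.CWTransfer.ofHomeomorph e`: from a CW structure on `C ⊆ X` (`X` Hausdorff)
  and a homeomorphism `e : ↥C ≃ₜ Y` onto a space `Y` of a possibly larger universe, the CW
  structure on `Set.univ : Set Y` whose cells are those of `C` (indices lifted with `ULift`) and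
  whose characteristic maps are `e ∘ Φ`.
* `Literature.AlgebraicTopology.Homotopy.CWTransfer.finite_ofHomeomorph`: finiteness is preserved.
* Typical uses: `Y = ↥C` itself (`e = Homeomorph.refl`), and `Y = ULift ↥C` (`Homeomorph.ulift`),
  to move a concrete complex in `ℝᴺ` into the universe of a given manifold.

All proofs are elementary point-set bookkeeping; the weak topology transfers because
`Y → X, y ↦ e⁻¹ y` is a closed embedding with image `C` (closed as `X` is Hausdorff,
`Topology.RelCWComplex.isClosed`). No `sorry`.

## References

* A. Hatcher, *Algebraic Topology*, CUP (2002), Appendix, "Topology of Cell Complexes",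
  pp. 519–523 (definition and weak topology, Prop. A.2). [HatcherAT2002]
-/

noncomputable section

open Set Metric Function Topology

universe u v

namespace Literature.AlgebraicTopology.Homotopy

namespace CWTransfer

/-! ### An auxiliary retraction of `X` onto the subtype `↥C` (junk off `C`) -/

section ToSubtype

variable {X : Type u} {C : Set X}

/-- Send `x ∈ C` to itself as an element of the subtype `↥C`, and everything else to the junk
value `x₀`. Used only on `C`. [folklore] -/
def toSubtype (x₀ : C) (x : X) : C := by
  classical
  exact if hx : x ∈ C then ⟨x, hx⟩ else x₀

/-- On `C`, `toSubtype` is the identity. [folklore] -/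
@[simp]
lemma toSubtype_of_mem (x₀ : C) {x : X} (hx : x ∈ C) : toSubtype x₀ x = ⟨x, hx⟩ := by
  classical
  simp [toSubtype, hx]

/-- On `C`, `toSubtype` is the identity (subtype form). [folklore] -/
@[simp]
lemma toSubtype_coe (x₀ z : C) : toSubtype x₀ (z : X) = z := by
  rw [toSubtype_of_mem x₀ z.2]

/-- `toSubtype` is continuous on `C` (where it is the identity). [folklore] -/
lemma continuousOn_toSubtype [TopologicalSpace X] (x₀ : C) : ContinuousOn (toSubtype x₀) C := by
  rw [continuousOn_iff_continuous_restrict]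
  have : C.restrict (toSubtype x₀) = id := by
    ext z
    simp [Set.restrict_apply]
  rw [this]
  exact continuous_id

end ToSubtype

/-! ### The transferred characteristic maps -/

section Back

variable {X : Type u} [TopologicalSpace X] {C : Set X} {Y : Type (max u v)} [TopologicalSpace Y]
  (e : C ≃ₜ Y)

/-- The inverse homeomorphism followed by the inclusion, `Y → X`, `y ↦ e⁻¹(y)`: a closed embedding
with image `C`. [folklore] -/
def back (y : Y) : X := ((e.symm y : C) : X)

/-- `back e` is continuous. [folklore] -/
lemma continuous_back : Continuous (back e) :=
  continuous_subtype_val.comp e.symm.continuous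

/-- `back e` is injective. [folklore] -/
lemma back_injective : Injective (back e) :=
  Subtype.val_injective.comp e.symm.injective

/-- `back e` takes values in `C`. [folklore] -/
lemma back_mem (y : Y) : back e y ∈ C := (e.symm y).2

/-- `back e (e z) = z`. [folklore] -/
@[simp]
lemma back_apply (z : C) : back e (e z) = z := by
  simp [back]

/-- `back e` is a closed embedding when `C` is closed. [folklore] -/
lemma isClosedEmbedding_back (hC : IsClosed C) : IsClosedEmbedding (back e) :=
  hC.isClosedEmbedding_subtypeVal.comp e.symm.isClosedEmbedding

/-- For `A ⊆ C`, `back e` undoes `e` on `A`: `back e '' (e '' (val ⁻¹' A)) = A`. [folklore] -/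
lemma image_back_image {A : Set X} (hA : A ⊆ C) :
    back e '' (e '' (Subtype.val ⁻¹' A)) = A := by
  ext x
  simp only [mem_image, mem_preimage]
  constructor
  · rintro ⟨y, ⟨z, hz, rfl⟩, rfl⟩
    simpa using hz
  · intro hx
    exact ⟨e ⟨x, hA hx⟩, ⟨⟨x, hA hx⟩, hx, rfl⟩, by simp⟩

end Back

section Transfer

variable {X : Type u} [TopologicalSpace X] {C : Set X} [_root_.Topology.CWComplex C]
  {Y : Type (max u v)} [TopologicalSpace Y] (e : C ≃ₜ Y)

/-- The **transferred characteristic map** of the cell `i`: `e ∘ Φᵢ` on the closed ball (junk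
elsewhere), with inverse `Φᵢ⁻¹ ∘ e⁻¹`. [folklore] -/
def transferMap (n : ℕ) (i : RelCWComplex.cell C n) : PartialEquiv (Fin n → ℝ) Y where
  toFun x := e (toSubtype ⟨RelCWComplex.map n i 0, RelCWComplex.closedCell_subset_complex n i
    (RelCWComplex.map_zero_mem_closedCell n i)⟩ (RelCWComplex.map n i x))
  invFun y := (RelCWComplex.map n i).symm (back e y)
  source := ball 0 1
  target := back e ⁻¹' (RelCWComplex.map n i).target
  map_source' x hx := by
    have hx' : x ∈ (RelCWComplex.map n i).source := by
      rw [RelCWComplex.source_eq]; exact hx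
    have hC : RelCWComplex.map n i x ∈ C :=
      RelCWComplex.openCell_subset_complex n i ⟨x, hx, rfl⟩
    show back e (e (toSubtype _ (RelCWComplex.map n i x))) ∈ (RelCWComplex.map n i).target
    rw [toSubtype_of_mem _ hC, back_apply]
    exact (RelCWComplex.map n i).map_source hx'
  map_target' y hy := by
    have := (RelCWComplex.map n i).map_target hy
    rwa [RelCWComplex.source_eq] at this
  left_inv' x hx := by
    have hx' : x ∈ (RelCWComplex.map n i).source := by
      rw [RelCWComplex.source_eq]; exact hx
    have hC : RelCWComplex.map n i x ∈ C :=
      RelCWComplex.openCell_subset_complex n i ⟨x, hx, rfl⟩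
    show (RelCWComplex.map n i).symm (back e (e (toSubtype _ (RelCWComplex.map n i x)))) = x
    rw [toSubtype_of_mem _ hC, back_apply]
    exact (RelCWComplex.map n i).left_inv hx'
  right_inv' y hy := by
    show e (toSubtype _ (RelCWComplex.map n i ((RelCWComplex.map n i).symm (back e y)))) = y
    rw [(RelCWComplex.map n i).right_inv hy, back, toSubtype_coe, e.apply_symm_apply]

/-- On the closed ball the transferred map is `e ∘ Φᵢ`. [folklore] -/
lemma transferMap_apply {n : ℕ} (i : RelCWComplex.cell C n) {x : Fin n → ℝ}
    (hx : x ∈ closedBall (0 : Fin n → ℝ) 1) :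
    transferMap e n i x = e ⟨RelCWComplex.map n i x,
      RelCWComplex.closedCell_subset_complex n i ⟨x, hx, rfl⟩⟩ := by
  show e (toSubtype _ (RelCWComplex.map n i x)) = _
  rw [toSubtype_of_mem]

/-- Images of subsets of the closed ball under the transferred map. [folklore] -/
lemma transferMap_image {n : ℕ} (i : RelCWComplex.cell C n) {A : Set (Fin n → ℝ)}
    (hA : A ⊆ closedBall 0 1) :
    transferMap e n i '' A = e '' (Subtype.val ⁻¹' (RelCWComplex.map n i '' A)) := by
  ext y
  simp only [mem_image, mem_preimage]
  constructor
  · rintro ⟨x, hx, rfl⟩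
    exact ⟨⟨_, RelCWComplex.closedCell_subset_complex n i ⟨x, hA hx, rfl⟩⟩, ⟨x, hx, rfl⟩,
      (transferMap_apply e i (hA hx)).symm⟩
  · rintro ⟨z, ⟨x, hx, hxz⟩, rfl⟩
    refine ⟨x, hx, ?_⟩
    rw [transferMap_apply e i (hA hx)]
    congr 1
    exact Subtype.ext hxz

/-- **Transfer of a CW structure along a homeomorphism.** If `C ⊆ X` (`X` Hausdorff) carries a
classical CW structure and `e : ↥C ≃ₜ Y`, then `Set.univ : Set Y` carries the CW structure with
the same cells (indices lifted by `ULift` to the universe of `Y`) and characteristic maps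
`e ∘ Φᵢ`; closure finiteness and the weak topology (Hatcher 2002, Prop. A.2) are transported
along the closed embedding `y ↦ e⁻¹(y)`. [cite: HatcherAT2002, Appendix pp. 519–521 (definition of CW complex)] -/
@[reducible]
def ofHomeomorph [T2Space X] : _root_.Topology.CWComplex (univ : Set Y) where
  cell n := ULift.{max u v} (RelCWComplex.cell C n)
  map n i := transferMap e n i.down
  source_eq _ _ := rfl
  continuousOn n i := by
    have h1 : MapsTo (RelCWComplex.map n i.down) (closedBall 0 1) C := fun x hx =>
      RelCWComplex.closedCell_subset_complex n i.down ⟨x, hx, rfl⟩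
    show ContinuousOn (fun x => e (toSubtype _ (RelCWComplex.map n i.down x))) (closedBall 0 1)
    exact e.continuous.comp_continuousOn
      ((continuousOn_toSubtype _).comp (RelCWComplex.continuousOn n i.down) h1)
  continuousOn_symm n i := by
    show ContinuousOn (fun y => (RelCWComplex.map n i.down).symm (back e y))
      (back e ⁻¹' (RelCWComplex.map n i.down).target)
    exact (RelCWComplex.continuousOn_symm n i.down).comp (continuous_back e).continuousOn
      (mapsTo_preimage _ _)
  pairwiseDisjoint' := by
    rintro ⟨n, ⟨i⟩⟩ - ⟨m, ⟨j⟩⟩ - hne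
    have hne' : (⟨n, i⟩ : Σ n, RelCWComplex.cell C n) ≠ ⟨m, j⟩ := fun h => hne (by cases h; rfl)
    show Disjoint (transferMap e n i '' ball 0 1) (transferMap e m j '' ball 0 1)
    rw [transferMap_image e i ball_subset_closedBall,
      transferMap_image e j ball_subset_closedBall, disjoint_image_iff e.injective]
    exact (RelCWComplex.disjoint_openCell_of_ne hne').preimage Subtype.val
  mapsTo' n i := by
    classical
    obtain ⟨I, hI⟩ := _root_.Topology.CWComplex.mapsTo n i.down
    refine ⟨fun m => (I m).map ⟨ULift.up, ULift.up_injective⟩, fun x hx => ?_⟩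
    have h1 := hI hx
    simp only [mem_iUnion] at h1 ⊢
    obtain ⟨m, hm, j, hj, hmem⟩ := h1
    refine ⟨m, hm, ⟨j⟩, by simpa using hj, ?_⟩
    show transferMap e n i.down x ∈ transferMap e m j '' closedBall 0 1
    rw [transferMap_image e j subset_rfl, transferMap_apply e i.down (sphere_subset_closedBall hx)]
    exact ⟨⟨_, _⟩, hmem, rfl⟩
  closed' A _ hA := by
    have hB : IsClosed (back e '' A) := by
      rw [_root_.Topology.CWComplex.closed C (back e '' A)
        (image_subset_iff.2 fun y _ => back_mem e y)]
      intro n j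
      have h1 : back e '' A ∩ RelCWComplex.closedCell n j =
          back e '' (A ∩ transferMap e n j '' closedBall 0 1) := by
        rw [image_inter (back_injective e), transferMap_image e j subset_rfl,
          image_back_image e (A := RelCWComplex.map n j '' closedBall 0 1)
            (RelCWComplex.closedCell_subset_complex n j)]
        rfl
      rw [h1]
      exact (isClosedEmbedding_back e (RelCWComplex.isClosed (C := C))).isClosedMap _ (hA n ⟨j⟩)
    rw [← preimage_image_eq A (back_injective e)]
    exact hB.preimage (continuous_back e)
  union' := by
    refine eq_univ_of_forall fun y => ?_
    have hy : back e y ∈ ⋃ (n : ℕ) (j : RelCWComplex.cell C n), RelCWComplex.closedCell n j := by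
      rw [_root_.Topology.CWComplex.union (C := C)]
      exact back_mem e y
    simp only [mem_iUnion] at hy ⊢
    obtain ⟨n, j, hmem⟩ := hy
    refine ⟨n, ⟨j⟩, ?_⟩
    show y ∈ transferMap e n j '' closedBall 0 1
    rw [transferMap_image e j subset_rfl]
    exact ⟨e.symm y, hmem, e.apply_symm_apply y⟩

/-- The cells of the transferred structure are (lifts of) the cells of `C`. [folklore] -/
lemma cell_ofHomeomorph [T2Space X] (n : ℕ) :
    (letI := ofHomeomorph.{u, v} e
     RelCWComplex.cell (univ : Set Y) n) = ULift.{max u v} (RelCWComplex.cell C n) := rfl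

/-- **Finiteness transfers**: if `C` is a finite CW complex, so is the transferred structure on
`Y`. [folklore] -/
lemma finite_ofHomeomorph [T2Space X] [RelCWComplex.Finite C] :
    letI := ofHomeomorph.{u, v} e
    RelCWComplex.Finite (univ : Set Y) := by
  letI := ofHomeomorph.{u, v} e
  exact
    { eventually_isEmpty_cell := by
        filter_upwards [RelCWComplex.FiniteDimensional.eventually_isEmpty_cell (C := C) (D := ∅)]
          with n hn
        exact ⟨fun j => hn.false (ULift.down j)⟩
      finite_cell := fun n => by
        have hfin : Finite (RelCWComplex.cell C n) :=
          RelCWComplex.FiniteType.finite_cell (C := C) (D := ∅) n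
        change Finite (ULift.{max u v} (RelCWComplex.cell C n))
        infer_instance }

end Transfer

end CWTransfer

end Literature.AlgebraicTopology.Homotopy

end
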